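import Literature.AnabelianGeometry.EtaleTheta.LogDivisorModelTateTower

/-!
# [EtTh] Def. 3.1 / Prop. 3.2 at the DOUBLE Tate tower `Ÿ`: the combinatorial skeleton WITH CUSPS and with the theta
# function `Θ̈` among the meromorphic functions (Tate tower v3, piece 1 — class (b) NV)

S. Mochizuki, *The étale theta function …*, Publ. RIMS **45** (2009) [MochizukiEtTh2009], §3 Def. 3.1 / Prop. 3.2 (PRIMS
p.70); the numbers are those of §1: Prop. 1.4 p.21 («the zeroes of `Θ̈` on `Ÿ` are precisely the cusps of `Ÿ`; each zero has
multiplicity 1. The divisor of poles of `Θ̈` on `Ÿ` is precisely the divisor `D_1`»), p.18 («`D_N` … corresponds to the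
function `j ↦ j²·log(q_X)/2N`»), Prop. 1.4 (ii) p.22 [cite: MochizukiEtTh2009, Def 3.1 p.70].

CLASS (b) MODEL / NON-VACUITY WITNESS (abc-iut cell, layer L2; seat abc-iut-L2-t3 (gen 7), row «TATE TOWER v3, PIECE 1: THE
`Ÿ`-SKELETON WITH CUSPS AND THE THETA FUNCTION», abc-iut-L2-lead R767; VNEXT-CENSUS-L2 «TATE/ℤ-TOWER v3 WITH CONSTANT FIELD AND
CUSPS»: at abc-iut-w6-d058's Tate skeleton `TateTower.model` — `Cusp := PEmpty`, `Fn = ⟨ϖ⟩ × ⟨U⟩` — every §5-junction divisor input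
concerning the CUSPS is vacuous).  Consumed BY NAME: the interface `LogDivisorModel`, `TateTower.divFun_nonneg_iff` /
`TateTower.int_eq_zero_of_divisible` (abc-iut-w6-d058).  THIS FILE: the divisor skeleton of the double cover `Ÿ → Y` of §1 —
* `Comp := ℤ` (the chain of projective lines), **`Cusp := ℤ × Bool`** (the two zeros `Ü = ±q_X^{j/2}` of `Θ̈` on `F_j`),
  `DIV = ℤ^{Cusp ⊔ Comp}`, every log-divisor Cartier; non-cuspidal = vanishing on the cusps, cuspidal = vanishing on the chain
  (`IsCompl` PROVED);
* **`Fn := μ₂ × ⟨ϖ̈⟩ × ⟨Ü⟩ × ⟨Θ̈⟩ = Multiplicative (ZMod 2 × ℤ × ℤ × ℤ)`**, the uniformiser normalised `ord(ϖ̈) = ord(q_X^{1/2}) = 1` so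
  that `D_1` is INTEGRAL: `divisor((−1)^ε ϖ̈^c Ü^k Θ̈^t) = (F_j ↦ c + k·j − t·j², cusp (j, ±) ↦ t)` (Prop. 1.4 (i): simple zeros
  at all cusps, pole of order `j²·ord(q_X)/2 = j²` along `F_j`);
* constants `μ₂ × ⟨ϖ̈⟩`, `O^▷ = μ₂ × ϖ̈^ℕ`; **Prop. 3.2 (ii) PROVED non-trivially** (`divFun_nonneg_iff`: an effective principal divisor
  forces `t = 0` — non-negativity at the cusps, `−t·j²` dominant along the chain — then `k = 0`, `c ≥ 0`); Prop. 3.2 (iii)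
  PROVED; `divisor f = 0 ⟺ f ∈ μ₂`;
* the two halves of `div Θ̈` as effective log-divisors: `thetaZeros` (every cusp, multiplicity `1`; CUSPIDAL) and `thetaPoles = D_1`
  (`F_j ↦ j²`; NON-CUSPIDAL), `divisor_theta : divisor Θ̈ = thetaZeros / thetaPoles`.
The Galois action (translation of the chain with the shear of Prop. 1.4 (ii)), the cusp laws and the Def. 3.3 (iii) data are
piece 1b.  No roots of unity beyond `μ₂`, no constant field (separate rows).  HONEST FRAMING: a combinatorial consistency
witness read off Prop. 1.4 (NOT the formal scheme `Ÿ`); defs + theorems only, no Prop-valued fact, no instance, no notation,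
no sorry; nothing here bears on [IUTchIII] Cor. 3.12; no side taken; typed ≠ proved.
-/
noncomputable section

namespace Literature.AnabelianGeometry.EtaleTheta

open CategoryTheory

namespace LogDivisorModel

namespace TateTowerTheta

/-- The cusps of `Ÿ`: on the component `F_j` the two zeros `Ü = ±q_X^{j/2}` of `Θ̈` (Prop. 1.4 (i); `Θ̈|_{F_0} = Ü − Ü⁻¹`).
[cite: MochizukiEtTh2009, Prop 1.4 p.21] -/
abbrev Cusp : Type := ℤ × Bool

/-- Index of prime log-divisors of `Ÿ`: cusps `ℤ × Bool`, components `ℤ`. [cite: MochizukiEtTh2009, Def 3.1 p.70] -/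
abbrev Idx : Type := Cusp ⊕ ℤ

/-- Exponent vectors `(ε, c, k, t)` of the functions `(−1)^ε ϖ̈^c Ü^k Θ̈^t`. [cite: MochizukiEtTh2009, Def 3.1 p.70] -/
abbrev Exp : Type := ZMod 2 × ℤ × ℤ × ℤ

/-- The exponent of the uniformiser `ϖ̈` (`ord ϖ̈ = ord q_X^{1/2} = 1`). [cite: MochizukiEtTh2009, Def 3.1 p.70] -/
def eC (f : Exp) : ℤ := f.2.1
/-- The exponent of the coordinate `Ü`. [cite: MochizukiEtTh2009, Prop 1.4 p.21] -/
def eU (f : Exp) : ℤ := f.2.2.1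
/-- The exponent of the theta function `Θ̈`. [cite: MochizukiEtTh2009, Prop 1.4 p.21] -/
def eT (f : Exp) : ℤ := f.2.2.2

/-- `eC` is additive. [cite: MochizukiEtTh2009, Def 3.1 p.70] -/
@[simp] theorem eC_add (f g : Exp) : eC (f + g) = eC f + eC g := rfl
/-- `eU` is additive. [cite: MochizukiEtTh2009, Def 3.1 p.70] -/
@[simp] theorem eU_add (f g : Exp) : eU (f + g) = eU f + eU g := rfl
/-- `eT` is additive. [cite: MochizukiEtTh2009, Def 3.1 p.70] -/
@[simp] theorem eT_add (f g : Exp) : eT (f + g) = eT f + eT g := rfl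
/-- `eC (-f) = - eC f`. [cite: MochizukiEtTh2009, Def 3.1 p.70] -/
@[simp] theorem eC_neg (f : Exp) : eC (-f) = -eC f := rfl
/-- `eU (-f) = - eU f`. [cite: MochizukiEtTh2009, Def 3.1 p.70] -/
@[simp] theorem eU_neg (f : Exp) : eU (-f) = -eU f := rfl
/-- `eT (-f) = - eT f`. [cite: MochizukiEtTh2009, Def 3.1 p.70] -/
@[simp] theorem eT_neg (f : Exp) : eT (-f) = -eT f := rfl
/-- An exponent vector is determined by its sign and its three exponents. [cite: MochizukiEtTh2009, Def 3.1 p.70] -/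
theorem ext_exp {f g : Exp} (h₀ : f.1 = g.1) (h₁ : eC f = eC g) (h₂ : eU f = eU g) (h₃ : eT f = eT g) : f = g :=
  Prod.ext h₀ (Prod.ext h₁ (Prod.ext h₂ h₃))

/-- **The divisor of `(−1)^ε ϖ̈^c Ü^k Θ̈^t`** read off Prop. 1.4 (i): along the component `F_j` the order is `c + k·j − t·j²`
(`ord_{F_j} Ü = j`, pole of `Θ̈` of order `j²·ord(q_X)/2 = j²`), at each cusp it is `t` (simple zeros of `Θ̈`).
[cite: MochizukiEtTh2009, Prop 1.4 p.21] -/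
def divFun (f : Exp) : Idx → ℤ
  | Sum.inl _ => eT f
  | Sum.inr j => eC f + eU f * j - eT f * (j * j)

/-- `divFun` at a cusp. [cite: MochizukiEtTh2009, Prop 1.4 p.21] -/
@[simp] theorem divFun_inl (f : Exp) (c : Cusp) : divFun f (Sum.inl c) = eT f := rfl
/-- `divFun` along a component. [cite: MochizukiEtTh2009, Prop 1.4 p.21] -/
@[simp] theorem divFun_inr (f : Exp) (j : ℤ) : divFun f (Sum.inr j) = eC f + eU f * j - eT f * (j * j) := rfl

/-- `divFun` is additive. [cite: MochizukiEtTh2009, Def 3.1 p.70] -/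
theorem divFun_add (f g : Exp) : divFun (f + g) = divFun f + divFun g := by
  funext x
  rcases x with c | j
  · simp only [divFun_inl, eT_add, Pi.add_apply]
  · simp only [divFun_inr, eC_add, eU_add, eT_add, Pi.add_apply]; ring

/-- The divisor map `Fn = μ₂ × ℤ³ → DIV = ℤ^{Cusp ⊔ Comp}` as a homomorphism of multiplicative groups.
[cite: MochizukiEtTh2009, Def 3.1 p.70] -/
def divHom : Multiplicative Exp →* Multiplicative (Idx → ℤ) :=
  AddMonoidHom.toMultiplicative
    { toFun := divFun
      map_zero' := by funext x; rcases x with c | j <;> simp [divFun, eC, eU, eT]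
      map_add' := divFun_add }

/-- `divHom` on elements. [cite: MochizukiEtTh2009, Def 3.1 p.70] -/
@[simp] theorem toAdd_divHom (f : Multiplicative Exp) (x : Idx) :
    Multiplicative.toAdd (divHom f) x = divFun (Multiplicative.toAdd f) x := rfl

/-- **Key computation (Prop. 3.2 (ii) for `Ÿ`)**: the divisor of `(−1)^ε ϖ̈^c Ü^k Θ̈^t` is effective iff `t = 0`, `k = 0` and
`c ≥ 0` (non-negativity at the cusps gives `t ≥ 0`; along the chain `−t·j²` dominates, so `t = 0`; then
`TateTower.divFun_nonneg_iff`). [cite: MochizukiEtTh2009, Prop 3.2 p.70] -/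
theorem divFun_nonneg_iff (f : Exp) : (∀ x, 0 ≤ divFun f x) ↔ eT f = 0 ∧ eU f = 0 ∧ 0 ≤ eC f := by
  constructor
  · intro h
    have ht0 : 0 ≤ eT f := h (Sum.inl (0, false))
    have ht : eT f = 0 := by
      by_contra hne
      have ht1 : 1 ≤ eT f := lt_of_le_of_ne ht0 (Ne.symm hne)
      -- evaluate along the component `j = |c| + |k| + 1`
      have hj := h (Sum.inr (|eC f| + |eU f| + 1))
      simp only [divFun_inr] at hj
      have h1 : eC f ≤ |eC f| := le_abs_self _
      have h2 : eU f * (|eC f| + |eU f| + 1) ≤ |eU f| * (|eC f| + |eU f| + 1) :=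
        mul_le_mul_of_nonneg_right (le_abs_self _) (by positivity)
      have h3 : (|eC f| + |eU f| + 1) * (|eC f| + |eU f| + 1) ≤ eT f * ((|eC f| + |eU f| + 1) * (|eC f| + |eU f| + 1)) :=
        le_mul_of_one_le_left (by positivity) ht1
      nlinarith [abs_nonneg (eC f), abs_nonneg (eU f)]
    have h' : ∀ x : TateTower.Idx, 0 ≤ TateTower.divFun (eC f, eU f) x := by
      rintro (c | j)
      · exact c.elim
      · have hj := h (Sum.inr j)
        simp only [divFun_inr, ht, zero_mul, sub_zero] at hj
        exact hj
    rw [TateTower.divFun_nonneg_iff] at h'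
    exact ⟨ht, h'.1, h'.2⟩
  · rintro ⟨ht, hk, hc⟩ x
    rcases x with c | j
    · rw [divFun_inl, ht]
    · rw [divFun_inr, ht, hk, zero_mul, zero_mul, add_zero, sub_zero]; exact hc

/-! ## The interface inhabitant -/

/-- Effective log-divisors of `Ÿ`: non-negative multiplicity at every prime log-divisor. [cite: MochizukiEtTh2009, Def 3.1 p.70] -/
def effective : Submonoid (Multiplicative (Idx → ℤ)) where
  carrier := {d | ∀ x, 0 ≤ Multiplicative.toAdd d x}
  mul_mem' := fun {a b} ha hb x => by rw [toAdd_mul, Pi.add_apply]; exact add_nonneg (ha x) (hb x)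
  one_mem' := fun x => by rw [toAdd_one, Pi.zero_apply]

/-- Membership in `effective`, for a divisor given additively. [cite: MochizukiEtTh2009, Def 3.1 p.70] -/
theorem ofAdd_mem_effective_iff (g : Idx → ℤ) : Multiplicative.ofAdd g ∈ effective ↔ ∀ x, 0 ≤ g x := Iff.rfl

/-- Non-cuspidal log-divisors: no multiplicity at the cusps. [cite: MochizukiEtTh2009, Def 3.1 p.70] -/
def nonCusp : Subgroup (Multiplicative (Idx → ℤ)) where
  carrier := {d | ∀ c : Cusp, Multiplicative.toAdd d (Sum.inl c) = 0}
  mul_mem' := fun {a b} ha hb c => by rw [toAdd_mul, Pi.add_apply, ha c, hb c, add_zero]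
  one_mem' := fun c => by rw [toAdd_one, Pi.zero_apply]
  inv_mem' := fun {a} ha c => by rw [toAdd_inv, Pi.neg_apply, ha c, neg_zero]

/-- Cuspidal log-divisors: no multiplicity along the special fibre. [cite: MochizukiEtTh2009, Def 3.1 p.70] -/
def cusp : Subgroup (Multiplicative (Idx → ℤ)) where
  carrier := {d | ∀ j : ℤ, Multiplicative.toAdd d (Sum.inr j) = 0}
  mul_mem' := fun {a b} ha hb j => by rw [toAdd_mul, Pi.add_apply, ha j, hb j, add_zero]
  one_mem' := fun j => by rw [toAdd_one, Pi.zero_apply]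
  inv_mem' := fun {a} ha j => by rw [toAdd_inv, Pi.neg_apply, ha j, neg_zero]

/-- **A log-divisor is uniquely the sum of a non-cuspidal and a cuspidal one.** [cite: MochizukiEtTh2009, Def 3.1 p.70] -/
theorem isCompl_nonCusp_cusp : IsCompl nonCusp cusp := by
  refine ⟨Subgroup.disjoint_def.mpr fun {d} hn hc => ?_, codisjoint_iff.mpr (eq_top_iff.mpr fun d _ => ?_)⟩
  · refine Multiplicative.toAdd.injective (funext fun x => ?_)
    rcases x with c | j
    · rw [hn c, toAdd_one, Pi.zero_apply]
    · rw [hc j, toAdd_one, Pi.zero_apply]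
  · -- `d = (d restricted to the chain) · (d restricted to the cusps)`
    let a : Multiplicative (Idx → ℤ) := Multiplicative.ofAdd fun x => Sum.elim (fun _ => 0) (fun j => Multiplicative.toAdd d (Sum.inr j)) x
    let b : Multiplicative (Idx → ℤ) := Multiplicative.ofAdd fun x => Sum.elim (fun c => Multiplicative.toAdd d (Sum.inl c)) (fun _ => 0) x
    have hab : d = a * b := Multiplicative.toAdd.injective (funext fun x => by rcases x with c | j <;> simp [a, b])
    rw [hab]
    exact Subgroup.mul_mem_sup (fun c => by simp [a]) (fun j => by simp [b])

/-- The constants `μ₂ × ⟨ϖ̈⟩` of `Ÿ` (`L^× ∩ Fn`). [cite: MochizukiEtTh2009, Def 3.1 p.70] -/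
def constants : Subgroup (Multiplicative Exp) where
  carrier := {f | eU (Multiplicative.toAdd f) = 0 ∧ eT (Multiplicative.toAdd f) = 0}
  mul_mem' := fun {a b} ha hb =>
    ⟨by rw [toAdd_mul, eU_add, ha.1, hb.1, add_zero], by rw [toAdd_mul, eT_add, ha.2, hb.2, add_zero]⟩
  one_mem' := ⟨rfl, rfl⟩
  inv_mem' := fun {a} ha => ⟨by rw [toAdd_inv, eU_neg, ha.1, neg_zero], by rw [toAdd_inv, eT_neg, ha.2, neg_zero]⟩

/-- The integral constants `O^▷ = μ₂ × ϖ̈^ℕ`. [cite: MochizukiEtTh2009, Prop 3.2 p.70] -/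
def intConstants : Submonoid (Multiplicative Exp) where
  carrier := {f | 0 ≤ eC (Multiplicative.toAdd f) ∧ eU (Multiplicative.toAdd f) = 0 ∧ eT (Multiplicative.toAdd f) = 0}
  mul_mem' := fun {a b} ha hb => ⟨by rw [toAdd_mul, eC_add]; exact add_nonneg ha.1 hb.1,
    by rw [toAdd_mul, eU_add, ha.2.1, hb.2.1, add_zero], by rw [toAdd_mul, eT_add, ha.2.2, hb.2.2, add_zero]⟩
  one_mem' := ⟨le_rfl, rfl, rfl⟩

/-- **The `Ÿ`-skeleton with cusps and theta as an inhabitant of the Def. 3.1 / Prop. 3.2 interface** (every field proved).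
[cite: MochizukiEtTh2009, Def 3.1 p.70] -/
def model : LogDivisorModel.{0} where
  Fn := Multiplicative Exp
  DIV := Multiplicative (Idx → ℤ)
  DIVplus := effective
  Div := ⊤
  exists_div_eq d := by
    refine ⟨Multiplicative.ofAdd fun x => max (Multiplicative.toAdd d x) 0,
      (ofAdd_mem_effective_iff _).2 fun x => le_max_right _ _,
      Multiplicative.ofAdd fun x => max (-Multiplicative.toAdd d x) 0,
      (ofAdd_mem_effective_iff _).2 fun x => le_max_right _ _, ?_⟩
    · refine Multiplicative.toAdd.injective (funext fun x => ?_)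
      rw [toAdd_mul, toAdd_ofAdd, toAdd_ofAdd, Pi.add_apply]
      rcases le_total 0 (Multiplicative.toAdd d x) with h | h
      · rw [max_eq_left h, max_eq_right (neg_nonpos.mpr h), add_zero]
      · rw [max_eq_right h, max_eq_left (neg_nonneg.mpr h), add_neg_cancel]
  eq_one_of_mem_of_inv_mem d hd hd' := by
    refine Multiplicative.toAdd.injective (funext fun x => le_antisymm ?_ (hd x))
    have h : 0 ≤ Multiplicative.toAdd d⁻¹ x := hd' x
    rw [toAdd_inv, Pi.neg_apply] at h
    rw [toAdd_one, Pi.zero_apply]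
    linarith
  nonCuspidal := nonCusp
  cuspidal := cusp
  nonCuspidal_isCompl_cuspidal := isCompl_nonCusp_cusp
  logMero := ⊤
  divisor := divHom.comp (Subgroup.subtype ⊤)
  divisor_mem_Div _ := trivial
  const := constants
  const_le_logMero := le_top
  intConst := intConstants
  intConst_le_const := fun _ hf => ⟨hf.2.1, hf.2.2⟩
  temperedMero := ⊤
  temperedMero_le_logMero := le_rfl
  exists_pow_mem_Div := ⟨1, fun _ => trivial⟩
  Cusp := Cusp
  Comp := ℤ
  divPlusEquiv :=
    { toFun := fun d x => Multiplicative.ofAdd (Multiplicative.toAdd d.1 x).toNat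
      invFun := fun m => ⟨Multiplicative.ofAdd fun x => ((Multiplicative.toAdd (m x) : ℕ) : ℤ),
        (ofAdd_mem_effective_iff _).2 fun x => Int.natCast_nonneg _⟩
      left_inv := fun d => Subtype.ext (Multiplicative.toAdd.injective (funext fun x => by
        simp only [toAdd_ofAdd]
        exact Int.toNat_of_nonneg (d.2 x)))
      right_inv := fun m => funext fun x => by simp
      map_mul' := fun a b => funext fun x => by
        rw [Pi.mul_apply, ← ofAdd_add]
        congr 1
        rw [Submonoid.coe_mul, toAdd_mul, Pi.add_apply]
        exact Int.toNat_add (a.2 x) (b.2 x) }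
  divPlusEquiv_nonCuspidal d := by
    change (∀ c : Cusp, Multiplicative.toAdd d.1 (Sum.inl c) = 0) ↔
      ∀ c : Cusp, Multiplicative.ofAdd (Multiplicative.toAdd d.1 (Sum.inl c)).toNat = 1
    refine forall_congr' fun c => ?_
    rw [← ofAdd_zero, Multiplicative.ofAdd.injective.eq_iff, Int.toNat_eq_zero]
    exact ⟨fun h => h.le, fun h => le_antisymm h (d.2 _)⟩
  mem_intConst_of_divisor_mem f hf := by
    have h : ∀ x, 0 ≤ divFun (Multiplicative.toAdd f.1) x := hf
    rw [divFun_nonneg_iff] at h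
    exact ⟨h.2.2, h.2.1, h.1⟩
  divisor_mem_of_mem_intConst f hf := by
    refine ⟨fun x => ?_, fun c => ?_⟩
    · change 0 ≤ divFun (Multiplicative.toAdd f.1) x
      exact (divFun_nonneg_iff _).2 ⟨hf.2.2, hf.2.1, hf.1⟩ x
    · change divFun (Multiplicative.toAdd f.1) (Sum.inl c) = 0
      rw [divFun_inl, hf.2.2]
  divisor_eq_one_iff f := by
    constructor
    · intro h
      have h' : ∀ x, divFun (Multiplicative.toAdd f.1) x = 0 := fun x => by
        have e := congrArg (fun d : Multiplicative (Idx → ℤ) => Multiplicative.toAdd d x) h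
        rw [toAdd_one, Pi.zero_apply] at e
        exact e
      have ht : eT (Multiplicative.toAdd f.1) = 0 := by simpa using h' (Sum.inl (0, false))
      have hc : eC (Multiplicative.toAdd f.1) = 0 := by simpa [ht] using h' (Sum.inr 0)
      have hk : eU (Multiplicative.toAdd f.1) = 0 := by simpa [ht, hc] using h' (Sum.inr 1)
      exact ⟨⟨hc.ge, hk, ht⟩, by change 0 ≤ eC (Multiplicative.toAdd (f.1)⁻¹); rw [toAdd_inv, eC_neg, hc, neg_zero],
        by change eU (Multiplicative.toAdd (f.1)⁻¹) = 0; rw [toAdd_inv, eU_neg, hk, neg_zero],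
        by change eT (Multiplicative.toAdd (f.1)⁻¹) = 0; rw [toAdd_inv, eT_neg, ht, neg_zero]⟩
    · rintro ⟨⟨hc, hk, ht⟩, hc', -, -⟩
      have hc'' : eC (Multiplicative.toAdd f.1) ≤ 0 := by
        have : 0 ≤ eC (Multiplicative.toAdd (f.1)⁻¹) := hc'
        rw [toAdd_inv, eC_neg] at this
        linarith
      refine Multiplicative.toAdd.injective (funext fun x => ?_)
      change divFun (Multiplicative.toAdd f.1) x = 0
      rcases x with c | j
      · rw [divFun_inl, ht]
      · rw [divFun_inr, hk, ht, le_antisymm hc'' hc]; ring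
  eq_one_of_forall_exists_pow_eq f hf := by
    -- an infinitely divisible element of `μ₂ × ℤ³` is trivial
    have hZ : ∀ (π : Exp →+ ℤ), (∀ N : ℕ+, ∃ b : ℤ, ((N : ℕ) : ℤ) * b = π (Multiplicative.toAdd f)) := fun π N => by
      obtain ⟨g, hg⟩ := hf N
      refine ⟨π (Multiplicative.toAdd g), ?_⟩
      have e := congrArg (fun u : Multiplicative Exp => π (Multiplicative.toAdd u)) hg
      rw [toAdd_pow, map_nsmul, nsmul_eq_mul] at e
      exact e
    let πC : Exp →+ ℤ := (AddMonoidHom.fst ℤ (ℤ × ℤ)).comp (AddMonoidHom.snd (ZMod 2) (ℤ × ℤ × ℤ))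
    let πU : Exp →+ ℤ :=
      (AddMonoidHom.fst ℤ ℤ).comp ((AddMonoidHom.snd ℤ (ℤ × ℤ)).comp (AddMonoidHom.snd (ZMod 2) (ℤ × ℤ × ℤ)))
    let πT : Exp →+ ℤ :=
      (AddMonoidHom.snd ℤ ℤ).comp ((AddMonoidHom.snd ℤ (ℤ × ℤ)).comp (AddMonoidHom.snd (ZMod 2) (ℤ × ℤ × ℤ)))
    have hC : eC (Multiplicative.toAdd f) = 0 := TateTower.int_eq_zero_of_divisible _ (hZ πC)
    have hU : eU (Multiplicative.toAdd f) = 0 := TateTower.int_eq_zero_of_divisible _ (hZ πU)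
    have hT : eT (Multiplicative.toAdd f) = 0 := TateTower.int_eq_zero_of_divisible _ (hZ πT)
    have hε : (Multiplicative.toAdd f).1 = 0 := by
      obtain ⟨g, hg⟩ := hf 2
      have e := congrArg (fun u : Multiplicative Exp => (Multiplicative.toAdd u).1) hg
      simp only [toAdd_pow, Prod.smul_fst, PNat.val_ofNat] at e
      rw [← e]
      have h2 : (2 : ZMod 2) = 0 := rfl
      rw [nsmul_eq_mul, Nat.cast_ofNat, h2, zero_mul]
    exact Multiplicative.toAdd.injective (ext_exp hε hC hU hT)

/-- The divisor of a function of the skeleton, on multiplicities. [cite: MochizukiEtTh2009, Def 3.1 p.70] -/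
theorem toAdd_divisor (f : model.logMero) (x : Idx) :
    Multiplicative.toAdd (model.divisor f) x = divFun (Multiplicative.toAdd f.1) x := rfl

/-! ## The theta function and the two halves of its divisor -/

/-- The theta function `Θ̈ = (−1)^0 ϖ̈^0 Ü^0 Θ̈^1 ∈ Fn`. [cite: MochizukiEtTh2009, Prop 1.4 p.21] -/
def theta : model.Fn := Multiplicative.ofAdd ((0, 0, 0, 1) : Exp)

/-- The divisor of zeros of `Θ̈`, additively: `1` at each cusp, `0` along the chain. [cite: MochizukiEtTh2009, Prop 1.4 p.21] -/
def zerosFun : Idx → ℤ := fun x => Sum.elim (fun _ => 1) (fun _ => 0) x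

/-- The divisor of poles `D_1` of `Θ̈`, additively: `0` at the cusps, `j²` along `F_j` (p.18 at `N = 1`, units `ord q_X^{1/2} = 1`).
[cite: MochizukiEtTh2009, Prop 1.4 p.21] -/
def polesFun : Idx → ℤ := fun x => Sum.elim (fun _ => 0) (fun j => j * j) x

/-- **The divisor of zeros of `Θ̈`**: every cusp with multiplicity `1` (Prop. 1.4 (i)), as an effective log-divisor.
[cite: MochizukiEtTh2009, Prop 1.4 p.21] -/
def thetaZeros : model.DIVplus :=
  ⟨Multiplicative.ofAdd zerosFun, (ofAdd_mem_effective_iff _).2 fun x => by rcases x with c | j <;> simp [zerosFun]⟩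

/-- **The divisor of poles `D_1` of `Θ̈`** as an effective log-divisor. [cite: MochizukiEtTh2009, Prop 1.4 p.21] -/
def thetaPoles : model.DIVplus :=
  ⟨Multiplicative.ofAdd polesFun, (ofAdd_mem_effective_iff _).2 fun x => by
      rcases x with c | j <;> [simp [polesFun]; simpa [polesFun] using mul_self_nonneg j]⟩

/-- The zero divisor, additively. [cite: MochizukiEtTh2009, Prop 1.4 p.21] -/
theorem toAdd_thetaZeros : Multiplicative.toAdd (thetaZeros : model.DIV) = zerosFun := rfl

/-- `D_1`, additively. [cite: MochizukiEtTh2009, Prop 1.4 p.21] -/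
theorem toAdd_thetaPoles : Multiplicative.toAdd (thetaPoles : model.DIV) = polesFun := rfl

/-- Multiplicities in the model are the non-negative values. [cite: MochizukiEtTh2009, Def 3.1 p.70] -/
theorem mult_eq (d : model.DIVplus) (x : Idx) : model.mult d x = (Multiplicative.toAdd (d : model.DIV) x).toNat := rfl

/-- Multiplicities of the zero divisor: `1` at each cusp, `0` along the chain. [cite: MochizukiEtTh2009, Prop 1.4 p.21] -/
theorem mult_thetaZeros (x : Idx) : model.mult thetaZeros x = Sum.elim (fun _ => 1) (fun _ => 0) x := by
  rcases x with c | j <;> rfl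

/-- Multiplicities of `D_1`: `0` at the cusps, `j²` along `F_j`. [cite: MochizukiEtTh2009, Prop 1.4 p.21] -/
theorem mult_thetaPoles (x : Idx) : model.mult thetaPoles x = Sum.elim (fun _ => 0) (fun j => (j * j).toNat) x := by
  rcases x with c | j <;> rfl

/-- The zero divisor of `Θ̈` is CUSPIDAL («the zeroes of `Θ̈` are precisely the cusps»). [cite: MochizukiEtTh2009, Prop 1.4 p.21] -/
theorem thetaZeros_mem_cuspidal : (thetaZeros : model.DIV) ∈ model.cuspidal := fun _ => rfl

/-- `D_1` is NON-CUSPIDAL (supported on the special fibre) and Cartier. [cite: MochizukiEtTh2009, Prop 1.4 p.21] -/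
theorem thetaPoles_mem_nonCuspidal : (thetaPoles : model.DIV) ∈ model.nonCuspidal ∧ (thetaPoles : model.DIV) ∈ model.Div :=
  ⟨fun _ => rfl, trivial⟩

/-- `Θ̈` is log-meromorphic (every function of the skeleton is). [cite: MochizukiEtTh2009, Def 3.1 p.70] -/
theorem theta_mem_logMero : theta ∈ model.logMero := Subgroup.mem_top _

/-- **Prop. 1.4 (i) in the skeleton: `divisor Θ̈ = (zeros at the cusps) − D_1`.** [cite: MochizukiEtTh2009, Prop 1.4 p.21] -/
theorem divisor_theta :
    model.divisor ⟨theta, theta_mem_logMero⟩ = (thetaZeros : model.DIV) / (thetaPoles : model.DIV) :=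
  Multiplicative.toAdd.injective (funext fun x => by
    show divFun ((0, 0, 0, 1) : Exp) x = zerosFun x - polesFun x
    rcases x with c | j
    · rfl
    · show (0 : ℤ) + 0 * j - 1 * (j * j) = 0 - j * j
      ring)

/-- The zero divisor of `Θ̈` is not trivial (the model HAS cusps — unlike the Tate skeleton `TateTower.model`).
[cite: MochizukiEtTh2009, Prop 1.4 p.21] -/
theorem thetaZeros_ne_one : thetaZeros ≠ 1 := fun h => by
  have e := congrArg (fun d : model.DIVplus => model.mult d (Sum.inl ((0 : ℤ), false))) h
  simp only [mult_thetaZeros, model.mult_one] at e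
  exact one_ne_zero e

/-- `D_1` is not trivial. [cite: MochizukiEtTh2009, Prop 1.4 p.21] -/
theorem thetaPoles_ne_one : thetaPoles ≠ 1 := fun h => by
  have e := congrArg (fun d : model.DIVplus => model.mult d (Sum.inr (1 : ℤ))) h
  simp only [mult_thetaPoles, model.mult_one] at e
  exact one_ne_zero e

end TateTowerTheta

end LogDivisorModel

end Literature.AnabelianGeometry.EtaleTheta

end
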